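import Literature.NumberTheory.GaloisRepresentations.LabelledWeightsInvariance
import Literature.NumberTheory.GaloisRepresentations.UnramifiedLabelledWeightsFinite
import Literature.NumberTheory.GaloisRepresentations.UnramifiedLiftingRing
import Literature.NumberTheory.GaloisRepresentations.UnramifiedDatum
import Literature.NumberTheory.GaloisRepresentations.CrystallineDeformationRingSmooth
import HarnessLib

/-!
# Labelled Hodge–Tate weights of unramified representations for the `K̂_nr` datum

For the unramified period-ring datum `𝔅 = K̂_nr` (`unramifiedPeriodRingData K p`; trivial
filtration) and a continuous UNRAMIFIED `ρ : Γ_K → GL_n(ℚ̄_p)` we PROVE, for every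
`ℚ_p`-embedding `τ : K → ℚ̄_p` (with `K/ℚ_p` finite):

* `finrank_labelD_eq_of_isLocallyUnramified` — `dim D_τ(ρ) = n` (model over a finite `E₀`
  — accepted `exists_hasQlModel_holds` — enlarged to `E' ⊇ τ'(K)` for all `τ'`; invariance under
  change of frame and of model, `LabelledWeightsInvariance`; the finite-level freeness theorem
  `UnramifiedLabelledWeightsFinite`);
* `labelledHodgeTateWeights_eq_replicate_of_isLocallyUnramified` — `HT_τ(ρ) = {0, …, 0}` (`n`
  times);
* `unramifiedPstWeilDeligneData_hasHodgeType_iff` — for the datum `unramifiedPstWeilDeligneData`,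
  an unramified `ρ` has Hodge type `v` iff `v τ = {0,…,0}` for all `τ`;
* `unramifiedPstWeilDeligneData_hasHodgeTypeCrystallineDeformationRings` — hence (as for the
  interval form, `UnramifiedCrystallineRings`) the universal unramified framed deformation rings
  are crystalline deformation rings of every occurring Hodge type for this datum.

HONEST NOTE: these are theorems about the TRUNCATED datum `K̂_nr` (crystalline = unramified),
not about Fontaine's `B_dR`; see `UnramifiedCrystallineRings` / `PstWeilDeligneInterfaceEvidence`.

No named facts, no `sorry`.

## References

* J.-M. Fontaine, Astérisque 223 (1994), Exp. III §1.5–1.6. [FontaineAsterisque223III]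
* S. Patrikis, *Variations on a theorem of Tate*, Mem. AMS 258 (2019), §2.3.1, §2.7.1. [Patrikis2019]
-/

noncomputable section

open TensorProduct Module Field
open scoped MatrixGroups

namespace Literature.NumberTheory.GaloisRepresentations

open IsNonarchimedeanLocalField Literature.NumberTheory.Automorphic PeriodRingData

-- Mathlib's own global value of `maxSynthPendingDepth` (see `LabelledWeightsTwist`); the large
-- tensor types also need a higher instance-synthesis budget.
set_option maxSynthPendingDepth 3
set_option synthInstance.maxHeartbeats 200000

variable {K : Type} [Field K] [ValuativeRel K] [TopologicalSpace K] [IsNonarchimedeanLocalField K]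
  {p : ℕ} [Fact p.Prime] [Algebra ℚ_[p] K]

/-! ### Weights for the trivial filtration -/

/-- For `K̂_nr` (trivial filtration) every labelled weight is `0`, with multiplicity `dim D_τ`. [folklore] -/
theorem labelledHodgeTateWeights_unramifiedPeriodRingData {E : Type*} [Field E] [Algebra ℚ_[p] E] [TopologicalSpace E]
    {M : Type*} [AddCommGroup M] [Module E M] [Module ℚ_[p] M] [IsScalarTower ℚ_[p] E M] [TopologicalSpace M]
    (ρ : ContinuousRep (absoluteGaloisGroup K) E M) (τ : K →+* E) :
    (unramifiedPeriodRingData K p).labelledHodgeTateWeights ρ τ =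
      Multiset.replicate (Module.finrank E ((unramifiedPeriodRingData K p).labelD ρ τ)) 0 := by
  rw [labelledHodgeTateWeights_def, ← jumpMultiset_step]
  congr 1
  funext i
  by_cases hi : i ≤ 0
  · rw [if_pos hi, labelFilD, coeffFilTensor_eq_top, inf_top_eq]
    exact unramifiedPeriodField.fil_of_nonpos (F := K) hi
  · rw [if_neg hi, labelFilD, coeffFilTensor_eq_bot, inf_bot_eq, finrank_bot]
    exact unramifiedPeriodField.fil_of_pos (F := K) (not_le.1 hi)

/-! ### A finite coefficient field containing all embeddings of `K` -/

section Enlarge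

variable [FiniteDimensional ℚ_[p] K]

omit [ValuativeRel K] [TopologicalSpace K] [IsNonarchimedeanLocalField K] in
/-- A finite extension `E'` of `ℚ_p` inside `ℚ̄_p` containing `E₀` and every `τ(K)`. [folklore] -/
theorem exists_intermediateField_ge_forall_fieldRange_le (E₀ : IntermediateField ℚ_[p] (PadicAlgCl p)) [FiniteDimensional ℚ_[p] E₀] :
    ∃ E' : IntermediateField ℚ_[p] (PadicAlgCl p), FiniteDimensional ℚ_[p] E' ∧ E₀ ≤ E' ∧
      ∀ τ : K →ₐ[ℚ_[p]] PadicAlgCl p, τ.fieldRange ≤ E' := by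
  classical
  let b := Module.finBasis ℚ_[p] K
  let S : Set (PadicAlgCl p) := Set.range fun q : (K →ₐ[ℚ_[p]] PadicAlgCl p) × Fin (Module.finrank ℚ_[p] K) => q.1 (b q.2)
  haveI : Finite S := Set.finite_range _
  haveI : FiniteDimensional ℚ_[p] (IntermediateField.adjoin ℚ_[p] S) :=
    IntermediateField.finiteDimensional_adjoin fun z _ => (Algebra.IsAlgebraic.isAlgebraic z).isIntegral
  refine ⟨E₀ ⊔ IntermediateField.adjoin ℚ_[p] S, IntermediateField.finiteDimensional_sup _ _, le_sup_left, fun τ => ?_⟩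
  rintro _ ⟨a, rfl⟩
  refine (le_sup_right : IntermediateField.adjoin ℚ_[p] S ≤ E₀ ⊔ IntermediateField.adjoin ℚ_[p] S) ?_
  change τ a ∈ IntermediateField.adjoin ℚ_[p] S
  rw [← b.sum_repr a, map_sum]
  refine sum_mem fun i _ => ?_
  rw [map_smul]
  exact IntermediateField.smul_mem _ (IntermediateField.subset_adjoin ℚ_[p] S ⟨⟨τ, i⟩, rfl⟩)

omit [ValuativeRel K] [TopologicalSpace K] [IsNonarchimedeanLocalField K] in
/-- If `E'` contains every `τ(K)`, then `E'` splits `K`: `#(K →ₐ E') = [K : ℚ_p]`. [folklore] -/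
theorem card_algHom_eq_finrank_of_forall_fieldRange_le (E' : IntermediateField ℚ_[p] (PadicAlgCl p))
    (hE' : ∀ τ : K →ₐ[ℚ_[p]] PadicAlgCl p, τ.fieldRange ≤ E') :
    Fintype.card (K →ₐ[ℚ_[p]] E') = Module.finrank ℚ_[p] K := by
  rw [← AlgHom.card ℚ_[p] K (PadicAlgCl p)]
  refine Fintype.card_congr
    { toFun := fun φ => (IsScalarTower.toAlgHom ℚ_[p] E' (PadicAlgCl p)).comp φ
      invFun := fun τ => (IntermediateField.inclusion (hE' τ)).comp τ.equivFieldRange.toAlgHom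
      left_inv := fun φ => AlgHom.ext fun x => Subtype.ext rfl
      right_inv := fun τ => AlgHom.ext fun x => rfl }

end Enlarge

/-! ### `dim D_τ(ρ) = n` for unramified `ρ` over `ℚ̄_p` -/

set_option synthInstance.maxHeartbeats 200000 in
/-- **`dim_{ℚ̄_p} D_τ(ρ) = n` for continuous unramified `ρ : Γ_K → GL_n(ℚ̄_p)`** and the datum
`K̂_nr`. [cite: FontaineAsterisque223III, Exp. III Prop. 1.6.2] [cite: Patrikis2019, §2.7.1] -/
theorem finrank_labelD_eq_of_isLocallyUnramified [FiniteDimensional ℚ_[p] K] {n : ℕ}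
    (ρ : FramedRep (absoluteGaloisGroup K) (PadicAlgCl p) n) (hρ : ρ.IsLocallyUnramified) (τ : K →ₐ[ℚ_[p]] PadicAlgCl p) :
    Module.finrank (PadicAlgCl p) ((unramifiedPeriodRingData K p).labelD (FramedRep.toContinuousRep ρ) τ.toRingHom) = n := by
  classical
  -- a model over a finite `E₀`, enlarged to `E'` containing all embeddings
  obtain ⟨E₀, rE₀, hfin, hmodel⟩ := exists_hasQlModel_holds ρ
  haveI : FiniteDimensional ℚ_[p] E₀ := hfin
  obtain ⟨E', hfin', hle, hE'⟩ := exists_intermediateField_ge_forall_fieldRange_le (K := K) E₀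
  haveI : FiniteDimensional ℚ_[p] E' := hfin'
  have hsplit := card_algHom_eq_finrank_of_forall_fieldRange_le (K := K) E' hE'
  -- the model over `E'`
  have hcont : Continuous (IntermediateField.inclusion hle).toRingHom := continuous_inclusion hle
  let rE' : FramedRep (absoluteGaloisGroup K) E' n := rE₀.baseChange (IntermediateField.inclusion hle).toRingHom hcont
  have hunr₀ : ∀ σ ∈ absInertia K, rE₀ σ = 1 := fun σ hσ =>
    eq_one_of_restrictScalarsQl_apply_eq_self rE₀ (restrictScalarsQl_apply_eq_self_of_isLocallyUnramified hρ hmodel σ hσ)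
  have hunr : ∀ σ ∈ absInertia K, rE' σ = 1 := fun σ hσ => by
    change Matrix.GeneralLinearGroup.map _ (rE₀ σ) = 1
    rw [hunr₀ σ hσ, map_one]
  -- `ρ` is a conjugate of the base change of `rE'`
  obtain ⟨Q, hQ⟩ := hmodel
  have hbc : rE'.baseChange (algebraMap E' (PadicAlgCl p)) continuous_subtype_val =
      rE₀.baseChange (algebraMap E₀ (PadicAlgCl p)) continuous_subtype_val :=
    ContinuousMonoidHom.ext fun g => Units.ext (Matrix.ext fun i j => rfl)
  have hρeq : ρ = (rE'.baseChange (algebraMap E' (PadicAlgCl p)) continuous_subtype_val).conj Q := by rw [hbc, hQ]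
  -- the embedding `τ` factors through `E'`
  let τ₀ : K →ₐ[ℚ_[p]] E' := (IntermediateField.inclusion (hE' τ)).comp τ.equivFieldRange.toAlgHom
  have hτ : τ.toRingHom = (extEmb (E := PadicAlgCl p) τ₀).toRingHom := RingHom.ext fun x => rfl
  -- finiteness of `D_{τ₀}(rE')` (it sits in the finite-dimensional `D(rE')`)
  haveI : ContinuousSMul ℚ_[p] E' := IntermediateField.continuousSMul_padicAlgCl E'
  have hρ' : ∀ σ ∈ absInertia K, ∀ v : Fin n → E', ((FramedRep.toContinuousRep rE').restrictScalars ℚ_[p]) σ v = v := by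
    intro σ hσ v
    rw [ContinuousRep.restrictScalars_apply, FramedRep.toContinuousRep_apply_apply, hunr σ hσ, Units.val_one, Matrix.one_mulVec]
  haveI : Module.Finite K ((unramifiedPeriodRingData K p).D ((FramedRep.toContinuousRep rE').restrictScalars ℚ_[p])) :=
    Module.rank_lt_aleph0_iff.1 (((unramifiedPeriodRingData K p).rank_D_le _).trans_lt Cardinal.natCast_lt_aleph0)
  have hadm : (unramifiedPeriodRingData K p).IsAdmissible ((FramedRep.toContinuousRep rE').restrictScalars ℚ_[p]) :=
    isAdmissible_unramifiedPeriodRingData_of_unramified K p _ hρ'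
  have hDeq : Module.finrank K ((unramifiedPeriodRingData K p).D ((FramedRep.toContinuousRep rE').restrictScalars ℚ_[p])) =
      Module.finrank ℚ_[p] (Fin n → E') := hadm
  obtain ⟨hfinC, -⟩ := (unramifiedPeriodRingData K p).finite_coeffD_and_finrank_le (FramedRep.toContinuousRep rE') hDeq.le
  haveI := hfinC
  haveI : FiniteDimensional E' ((unramifiedPeriodRingData K p).labelD (FramedRep.toContinuousRep rE') τ₀.toRingHom) :=
    Submodule.finiteDimensional_of_le ((unramifiedPeriodRingData K p).labelD_le_coeffD _ _)
  -- assemble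
  rw [hρeq, finrank_labelD_conj, hτ,
    (unramifiedPeriodRingData K p).finrank_labelD_baseChange rE' continuous_subtype_val hsplit τ₀]
  exact finrank_labelD_eq_of_unramified E' hsplit rE' hunr τ₀

/-- **All labelled Hodge–Tate weights of an unramified `ρ : Γ_K → GL_n(ℚ̄_p)` are `0`** (with
multiplicity `n`) for the datum `K̂_nr`. [cite: FontaineAsterisque223III, Exp. III Prop. 1.6.2] -/
theorem labelledHodgeTateWeights_eq_replicate_of_isLocallyUnramified [FiniteDimensional ℚ_[p] K] {n : ℕ}
    (ρ : FramedRep (absoluteGaloisGroup K) (PadicAlgCl p) n) (hρ : ρ.IsLocallyUnramified) (τ : K →ₐ[ℚ_[p]] PadicAlgCl p) :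
    (unramifiedPeriodRingData K p).labelledHodgeTateWeights (FramedRep.toContinuousRep ρ) τ.toRingHom = Multiset.replicate n 0 := by
  rw [labelledHodgeTateWeights_unramifiedPeriodRingData, finrank_labelD_eq_of_isLocallyUnramified ρ hρ τ]

/-- **Hodge types for the `K̂_nr` datum**: an unramified `ρ` has Hodge type `v` iff `v τ = {0,…,0}`
for every embedding `τ`. [folklore] -/
theorem unramifiedPstWeilDeligneData_hasHodgeType_iff [FiniteDimensional ℚ_[p] K] {n : ℕ}
    (v : (K →+* PadicAlgCl p) → Multiset ℤ) (ρ : FramedRep (absoluteGaloisGroup K) (PadicAlgCl p) n)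
    (hρ : ρ.IsLocallyUnramified) :
    (unramifiedPstWeilDeligneData K p).HasHodgeType v ρ ↔
      ∀ τ : K →ₐ[ℚ_[p]] PadicAlgCl p, v τ.toRingHom = Multiset.replicate n 0 := by
  rw [PstWeilDeligneData.hasHodgeType_iff]
  -- the `ℚ_p`-algebra structure recorded in the datum is the ambient one (definitionally)
  haveI : @FiniteDimensional ℚ_[p] K _ _ (unramifiedPstWeilDeligneData K p).algebra.toModule := ‹FiniteDimensional ℚ_[p] K›
  refine forall_congr' fun τ => ?_
  -- `τ` re-typed with the ambient algebra structure (the same map)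
  let τ' : K →ₐ[ℚ_[p]] PadicAlgCl p := ⟨τ.toRingHom, fun c => τ.commutes c⟩
  have key := labelledHodgeTateWeights_eq_replicate_of_isLocallyUnramified ρ hρ τ'
  change (unramifiedPeriodRingData K p).labelledHodgeTateWeights (FramedRep.toContinuousRep ρ) τ'.toRingHom = v τ'.toRingHom ↔
    v τ'.toRingHom = _
  rw [key, eq_comm]

/-! ### Crystalline deformation rings of given Hodge type for the `K̂_nr` datum -/

omit [ValuativeRel K] [TopologicalSpace K] [IsNonarchimedeanLocalField K] in
/-- `K` is finite over `ℚ_p` as soon as one `ℚ_p`-embedding of `K` lands in a finite extension. [folklore] -/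
theorem finiteDimensional_of_fieldRange_le (L : IntermediateField ℚ_[p] (PadicAlgCl p))
    [FiniteDimensional ℚ_[p] L] (τ : K →ₐ[ℚ_[p]] PadicAlgCl p) (hτ : ∀ a : K, τ a ∈ L) : FiniteDimensional ℚ_[p] K := by
  let f : K →ₗ[ℚ_[p]] L := (τ.toLinearMap.codRestrict (L.toSubalgebra.toSubmodule) hτ)
  refine Module.Finite.of_injective f fun x y hxy => ?_
  have h := congrArg Subtype.val hxy
  exact τ.toRingHom.injective h

variable (K p) in
/-- **The `K̂_nr` datum admits crystalline deformation rings of every occurring Hodge type**: the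
universal unramified framed deformation ring `𝒪_L⟦X_{ij}⟧` (`unramifiedLiftingRing`), since for
this datum "crystalline of Hodge type `v`" is "unramified and `v = 0`". (A theorem about the
TRUNCATED datum; see the module docstring.) [folklore] -/
theorem unramifiedPstWeilDeligneData_hasHodgeTypeCrystallineDeformationRings :
    (unramifiedPstWeilDeligneData K p).HasHodgeTypeCrystallineDeformationRings := by
  intro L _ hL n ρbar v h
  letI := intermediateFieldIntegers.algebraPadicAlgCl L
  letI : TopologicalSpace (IsLocalRing.ResidueField (intermediateFieldIntegers p L)) := ⊥
  haveI : IsScalarTower (intermediateFieldIntegers p L) L (PadicAlgCl p) := IsScalarTower.of_algebraMap_eq fun _ => rfl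
  haveI : DiscreteTopology (IsLocalRing.ResidueField (intermediateFieldIntegers p L)) := ⟨rfl⟩
  obtain ⟨ρ, hred, hcrys, hv⟩ := h
  have hunr : ρ.IsLocallyUnramified := (unramifiedPstWeilDeligneData_isCrystallineFramed_iff ρ).1 hcrys
  have hρbar : ρbar.IsLocallyUnramified := isLocallyUnramified_of_reducesTo L hred hunr
  by_cases hne : Nonempty (K →ₐ[ℚ_[p]] PadicAlgCl p)
  · obtain ⟨τ₁⟩ := hne
    haveI : FiniteDimensional ℚ_[p] K := finiteDimensional_of_fieldRange_le L τ₁ (hL τ₁)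
    have hQ : ∀ τ : K →ₐ[ℚ_[p]] PadicAlgCl p, v τ.toRingHom = Multiset.replicate n 0 :=
      (unramifiedPstWeilDeligneData_hasHodgeType_iff v ρ hunr).1 hv
    refine ⟨PointwiseLiftingRing.congr (fun ρ' => ?_) (unramifiedLiftingRing L ρbar hρbar _ hQ)⟩
    rw [unramifiedPstWeilDeligneData_isCrystallineFramed_iff]
    constructor
    · rintro ⟨h1, h2⟩; exact ⟨h1, (unramifiedPstWeilDeligneData_hasHodgeType_iff v ρ' h1).2 h2⟩
    · rintro ⟨h1, h2⟩; exact ⟨h1, (unramifiedPstWeilDeligneData_hasHodgeType_iff v ρ' h1).1 h2⟩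
  · have hvac : ∀ ρ' : FramedRep (absoluteGaloisGroup K) (PadicAlgCl p) n, (unramifiedPstWeilDeligneData K p).HasHodgeType v ρ' :=
      fun ρ' τ => (hne ⟨τ⟩).elim
    refine ⟨PointwiseLiftingRing.congr (fun ρ' => ?_) (unramifiedLiftingRing L ρbar hρbar True trivial)⟩
    rw [unramifiedPstWeilDeligneData_isCrystallineFramed_iff]
    exact ⟨fun h => ⟨h.1, hvac ρ'⟩, fun h => ⟨h.1, trivial⟩⟩

end Literature.NumberTheory.GaloisRepresentations

end
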